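import Literature.AlgebraicGeometry.Modules.CechLocalizedComplex
import Literature.AlgebraicGeometry.Modules.CechLocalizedSectionsQuasiIso
import Literature.AlgebraicGeometry.Modules.CechOrderedBicomplex
import HarnessLib

/-!
# The localized-sections Čech bicomplex `P̌•_ord(𝓤, I•)` and the quasi-isomorphism
# `Tot P̌•_ord(𝓤, I•) ⥲ Tot Č•_ord(𝓤, I•)` (Görtz–Wedhorn II Lemma 22.36 / (21.19); Thomason–Trobaugh B.16)

For a scheme `X`, a finite linearly ordered family of opens `𝓤 = (U_i)_{i ∈ ι}` and a cochain complex `I•` of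
`𝒪_X`-modules, the ordered complexes of localized-sections sheaves `P̌•_ord(𝓤, Iᵠ)` (`Modules/CechLocalizedComplex`:
`P̌ᵖ_ord(𝓤, F) = PCech.obj (faces U p) 0 F`, the sheafification of `V ↦ Π_{#s = p+1} Γ(X, V ∩ U_s) ⊗_{Γ(X, U_s)} Γ(F, U_s)`)
assemble, functorially in the sheaf, into a bicomplex mapping to the ordered Čech bicomplex of
`Modules/CechOrderedBicomplex` by the counit:

* §1 `PCechOrd.complexFunctor` (the complex `P̌•_ord(𝓤, F)` as a functor of `F`; preserves zero morphisms) and the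
  counit `PCechOrd.counitComplexNatTrans : P̌•_ord(𝓤, –) ⟶ Č•_ord(𝓤, –)`;
* §2 the column functor `PCechOrd.columnFunctor = complexFunctor ⋙ extend` (`ℤ`-complexes in degrees `≥ 0`) and
  `counitColumnNatTrans`;
* §3 **`PCechOrd.bicomplex U I`** (outer index the degree `q` of `I•`, column `q` the complex `P̌•_ord(𝓤, Iᵠ)`) and
  **`PCechOrd.bicomplexCounit U I : bicomplex U I ⟶ CechOrd.bicomplex U I`**;
* §4 the ROWS: at Čech degree `p`, the row of `bicomplexCounit` is, up to the `extend` isomorphisms, the counit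
  `P̌ᵖ(𝓤, I•) ⟶ Čᵖ(𝓤, I•)` of `Modules/CechLocalizedSectionsQuasiIso` for the family of `p`-faces
  (`flipCounitArrowIso`); rows of negative Čech degree vanish;
* §5 on a SEPARATED scheme with the `U_i` affine: the faces `U_s` (`s ≠ ∅`) are affine and the affine opens meet
  them in affines (`isAffineOpen_faceSet`, `isBasis_affine_inf_face`);
* §6 **`quasiIso_total_map_bicomplexCounit`**: for `I•` bounded below with terms acyclic on affine opens (e.g.
  injective) and affine-localizing (quasi-coherent) cohomology sheaves, `Tot(bicomplexCounit)` is a quasi-isomorphism —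
  every row is one (`PCech.quasiIso_counitComplexMap`) and row-wise quasi-isomorphisms of first-quadrant bicomplexes
  pass to total complexes (`Algebra/Homology/TotalQuasiIsoOfBoundedColumns.quasiIso_total_map_of_quasiIso_rows_of_isStrictlyGE`).

Together with `CechOrd.quasiIso_toTotal` (`I• ⥲ Tot Č•_ord(𝓤, I•)`) this is the zig-zag
`I• → Tot Č(𝓤, I•) ← Tot P̌(𝓤, I•)` of Stage I of the `D⁺_qc` comparison (Görtz–Wedhorn II Lemma 22.36 ∕ Hartshorne
RD II 7.19 ∕ Thomason–Trobaugh B.16); the terms of `Tot P̌` are quasi-coherent by `Modules/CechLocalizedSectionsAffineLocalizing`.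
Everything is PROVED; 0 named facts; no instances (zero-preservation of the functors is stated as theorems and bound
inside the definitions). Typed for the cell `pub-hodge-ring2` — a research route conditional on HC_CM, not a corollary;
nothing in this file refers to it.

## References

* U. Görtz, T. Wedhorn, *Algebraic Geometry II: Cohomology of Schemes*, Springer Spektrum (2023): (21.19), Def. 21.68,
  Lemma 21.75 (pp. 260–264), Lemma 22.36 and its proof (pp. 349–350). [GortzWedhorn2023]
* R. W. Thomason, T. Trobaugh, *Higher algebraic K-theory of schemes and of derived categories*, The Grothendieck
  Festschrift III (1990), Appendix B, B.16. [ThomasonTrobaugh1990]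
* R. Hartshorne, *Residues and Duality*, LNM 20 (1966), II Cor. 7.19 (p. 133). [HartshorneRD1966]
* C. A. Weibel, *An introduction to homological algebra* (1994), 1.2.6, 5.6 (double complexes). [Weibel1994]
-/

noncomputable section

-- `TopCat.Presheaf`/`Scheme.Modules` are not reducible (as in Mathlib's `AlgebraicGeometry/Modules/Sheaf.lean`).
set_option backward.isDefEq.respectTransparency false

universe u

open CategoryTheory CategoryTheory.Limits Opposite TopologicalSpace AlgebraicGeometry HomologicalComplex

namespace Literature.AlgebraicGeometry.Modules

namespace PCechOrd

open CechOrd Literature.Algebra.Homology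

variable {X : Scheme.{u}} {ι : Type u} [LinearOrder ι] [Fintype ι] (U : ι → X.Opens) {F G H : X.Modules}

/-! ## §1 `P̌•_ord(𝓤, –)` as a functor and the counit natural transformation -/

section Functoriality

/-- `P̌•_ord(𝓤, 𝟙) = 𝟙`. [cite: GortzWedhorn2023, Def. 21.68 (p. 260)] -/
theorem complexMap_id : complexMap U (𝟙 F) = 𝟙 _ := by
  ext n : 1
  rw [complexMap_f, PCech.map_id]
  rfl

/-- `P̌•_ord(𝓤, φ ≫ ψ) = P̌•_ord(𝓤, φ) ≫ P̌•_ord(𝓤, ψ)`. [cite: GortzWedhorn2023, Def. 21.68 (p. 260)] -/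
theorem complexMap_comp (φ : F ⟶ G) (ψ : G ⟶ H) : complexMap U (φ ≫ ψ) = complexMap U φ ≫ complexMap U ψ := by
  ext n : 1
  rw [complexMap_f, PCech.map_comp]
  rfl

/-- `P̌•_ord(𝓤, 0) = 0`. [cite: GortzWedhorn2023, Def. 21.68 (p. 260)] -/
theorem complexMap_zero : complexMap U (0 : F ⟶ G) = 0 := by
  ext n : 1
  rw [complexMap_f, PCech.map_zero']
  rfl

variable (X) in
/-- **The functor `F ↦ P̌•_ord(𝓤, F)`** (`Mod(𝒪_X) ⥤ C(Mod(𝒪_X), ℕ)`). [cite: GortzWedhorn2023, Def. 21.68 (p. 260) and Lemma 22.36 (p. 349)] -/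
def complexFunctor : X.Modules ⥤ CochainComplex X.Modules ℕ where
  obj F := complex U F
  map φ := complexMap U φ
  map_id _ := complexMap_id U
  map_comp φ ψ := complexMap_comp U φ ψ

/-- `complexFunctor` on objects (definitional). [cite: GortzWedhorn2023, Def. 21.68 (p. 260)] -/
theorem complexFunctor_obj (F : X.Modules) : (complexFunctor X U).obj F = complex U F := rfl

/-- `complexFunctor` on morphisms (definitional). [cite: GortzWedhorn2023, Def. 21.68 (p. 260)] -/
theorem complexFunctor_map (φ : F ⟶ G) : (complexFunctor X U).map φ = complexMap U φ := rfl

/-- `F ↦ P̌•_ord(𝓤, F)` preserves zero morphisms. [cite: GortzWedhorn2023, Def. 21.68 (p. 260)] -/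
theorem preservesZeroMorphisms_complexFunctor : (complexFunctor X U).PreservesZeroMorphisms :=
  ⟨fun _ _ => complexMap_zero U⟩

variable (X) in
/-- **The counit `P̌•_ord(𝓤, –) ⟶ Č•_ord(𝓤, –)`** as a natural transformation of complex-valued functors.
[cite: GortzWedhorn2023, Lemma 22.36 (p. 349)] -/
def counitComplexNatTrans : complexFunctor X U ⟶ CechOrd.complexFunctor X U where
  app F := counitComplex U F
  naturality _ _ φ := complexMap_counitComplex U φ

/-- Components of the counit transformation (definitional). [cite: GortzWedhorn2023, Lemma 22.36 (p. 349)] -/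
theorem counitComplexNatTrans_app (F : X.Modules) : (counitComplexNatTrans X U).app F = counitComplex U F := rfl

end Functoriality

/-! ## §2 The columns: `P̌•_ord(𝓤, F)` as a bounded-below `ℤ`-complex -/

section Columns

variable (X) in
/-- **The column functor** `F ↦ P̌•_ord(𝓤, F)` as a cochain complex indexed by `ℤ` (zero in negative degrees; Mathlib
`extend` along `embeddingUpNat`). [cite: GortzWedhorn2023, (21.19) (p. 262)] -/
def columnFunctor : X.Modules ⥤ CochainComplex X.Modules ℤ :=
  complexFunctor X U ⋙ ComplexShape.embeddingUpNat.extendFunctor X.Modules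

/-- `columnFunctor` on objects (definitional). [cite: GortzWedhorn2023, (21.19) (p. 262)] -/
theorem columnFunctor_obj (F : X.Modules) :
    (columnFunctor X U).obj F = (complex U F).extend ComplexShape.embeddingUpNat := rfl

/-- `columnFunctor` on morphisms (definitional). [cite: GortzWedhorn2023, (21.19) (p. 262)] -/
theorem columnFunctor_map (φ : F ⟶ G) :
    (columnFunctor X U).map φ = extendMap (complexMap U φ) ComplexShape.embeddingUpNat := rfl

/-- The column functor preserves zero morphisms. [cite: GortzWedhorn2023, (21.19) (p. 262)] -/
theorem preservesZeroMorphisms_columnFunctor : (columnFunctor X U).PreservesZeroMorphisms :=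
  haveI := preservesZeroMorphisms_complexFunctor U
  inferInstanceAs (complexFunctor X U ⋙ ComplexShape.embeddingUpNat.extendFunctor X.Modules).PreservesZeroMorphisms

/-- The columns are concentrated in degrees `≥ 0`. [cite: GortzWedhorn2023, (21.19) (p. 262)] -/
theorem isStrictlyGE_columnFunctor_obj (F : X.Modules) : CochainComplex.IsStrictlyGE ((columnFunctor X U).obj F) 0 :=
  inferInstanceAs (CochainComplex.IsStrictlyGE ((complex U F).extend ComplexShape.embeddingUpNat) 0)

variable (X) in
/-- **The counit of columns** `P̌•_ord(𝓤, –) ⟶ Č•_ord(𝓤, –)` as `ℤ`-complexes (the extension of `counitComplexNatTrans`).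
[cite: GortzWedhorn2023, Lemma 22.36 (p. 349)] -/
def counitColumnNatTrans : columnFunctor X U ⟶ CechOrd.columnFunctor X U :=
  Functor.whiskerRight (counitComplexNatTrans X U) (ComplexShape.embeddingUpNat.extendFunctor X.Modules)

/-- Components of the counit of columns. [cite: GortzWedhorn2023, Lemma 22.36 (p. 349)] -/
theorem counitColumnNatTrans_app (F : X.Modules) :
    (counitColumnNatTrans X U).app F = extendMap (counitComplex U F) ComplexShape.embeddingUpNat := rfl

end Columns

/-! ## §3 The bicomplex `P̌•_ord(𝓤, I•)` and its counit to `Č•_ord(𝓤, I•)` -/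

section Bicomplex

variable (I : CochainComplex X.Modules ℤ)

/-- **The localized-sections Čech bicomplex `P̌•_ord(𝓤, I•)` of a cochain complex of `𝒪_X`-modules**: outer index the
degree `q` of `I•`, column `q` the complex `P̌•_ord(𝓤, Iᵠ)` (in degrees `≥ 0`), maps between columns `P̌•(dᵠ)`.
[cite: GortzWedhorn2023, (21.19) (p. 262) and Lemma 22.36 (p. 349)] [cite: ThomasonTrobaugh1990, Appendix B, B.16] -/
def bicomplex : HomologicalComplex₂ X.Modules (ComplexShape.up ℤ) (ComplexShape.up ℤ) :=
  haveI := preservesZeroMorphisms_columnFunctor (X := X) U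
  ((columnFunctor X U).mapHomologicalComplex (ComplexShape.up ℤ)).obj I

/-- The columns of `P̌•_ord(𝓤, I•)` (definitional). [cite: GortzWedhorn2023, (21.19) (p. 262)] -/
theorem bicomplex_X (q : ℤ) : (bicomplex U I).X q = (complex U (I.X q)).extend ComplexShape.embeddingUpNat := rfl

/-- The maps between the columns of `P̌•_ord(𝓤, I•)` (definitional). [cite: GortzWedhorn2023, (21.19) (p. 262)] -/
theorem bicomplex_d (q q' : ℤ) :
    (bicomplex U I).d q q' = extendMap (complexMap U (I.d q q')) ComplexShape.embeddingUpNat := rfl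

/-- The entries of `P̌•_ord(𝓤, I•)` in non-negative Čech degree: `P̌ᵖ_ord(𝓤, Iᵠ) = PCech.obj (faces U p) 0 (Iᵠ)`.
[cite: GortzWedhorn2023, (21.19) (p. 262)] -/
def bicomplexXXIso (q : ℤ) (p : ℕ) : ((bicomplex U I).X q).X (p : ℤ) ≅ PCech.obj (faces U p) 0 (I.X q) :=
  (complex U (I.X q)).extendXIso ComplexShape.embeddingUpNat (i := p) rfl

/-- The entries of `P̌•_ord(𝓤, I•)` in negative Čech degree vanish. [cite: GortzWedhorn2023, (21.19) (p. 262)] -/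
theorem isZero_bicomplex_X_X (q p : ℤ) (hp : p < 0) : IsZero (((bicomplex U I).X q).X p) :=
  isZero_extend_X _ _ _ fun i (hi : ((i : ℕ) : ℤ) = p) => by omega

/-- `P̌•_ord(𝓤, I•)` has columns `≥ a` when `I•` is in degrees `≥ a`. [cite: GortzWedhorn2023, (21.19) (p. 262)] -/
theorem isStrictlyGE_bicomplex (a : ℤ) [I.IsStrictlyGE a] : CochainComplex.IsStrictlyGE (bicomplex U I) a := by
  haveI := preservesZeroMorphisms_columnFunctor (X := X) U
  rw [CochainComplex.isStrictlyGE_iff]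
  intro q hq
  exact Functor.map_isZero (columnFunctor X U) (I.isZero_of_isStrictlyGE a q hq)

/-- **The counit of bicomplexes `P̌•_ord(𝓤, I•) ⟶ Č•_ord(𝓤, I•)`** (column `q`: the extended counit chain map
`P̌•_ord(𝓤, Iᵠ) ⟶ Č•_ord(𝓤, Iᵠ)`). [cite: GortzWedhorn2023, Lemma 22.36 (p. 349)] [cite: ThomasonTrobaugh1990, Appendix B, B.16] -/
def bicomplexCounit : bicomplex U I ⟶ CechOrd.bicomplex U I :=
  haveI := preservesZeroMorphisms_columnFunctor (X := X) U
  haveI := CechOrd.additive_columnFunctor (X := X) U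
  (NatTrans.mapHomologicalComplex (counitColumnNatTrans X U) (ComplexShape.up ℤ)).app I

/-- The columns of the counit of bicomplexes. [cite: GortzWedhorn2023, Lemma 22.36 (p. 349)] -/
theorem bicomplexCounit_f (q : ℤ) :
    (bicomplexCounit U I).f q = extendMap (counitComplex U (I.X q)) ComplexShape.embeddingUpNat := rfl

end Bicomplex

/-! ## §4 The rows of the counit are the counits `P̌ᵖ(𝓤, I•) ⟶ Čᵖ(𝓤, I•)` of the families of `p`-faces -/

section Rows

variable (I : CochainComplex X.Modules ℤ)

/-- **Row `p` of `P̌•_ord(𝓤, I•)` is `P̌ᵖ(𝓤_p, I•)`** — the complex `PCech.complexP (faces U p) 0 I` of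
`Modules/CechLocalizedSectionsQuasiIso`, up to the `extend` isomorphisms. [cite: GortzWedhorn2023, (21.19) (p. 262)] -/
def rowIso (p : ℕ) : (bicomplex U I).flip.X (p : ℤ) ≅ PCech.complexP (faces U p) 0 I :=
  Hom.isoOfComponents (fun q => bicomplexXXIso U I q p) fun q q' _ => by
    change (bicomplexXXIso U I q p).hom ≫ PCech.map (faces U p) 0 (I.d q q') =
      ((bicomplex U I).d q q').f (p : ℤ) ≫ (bicomplexXXIso U I q' p).hom
    rw [bicomplex_d, extendMap_f _ ComplexShape.embeddingUpNat (i := p) (i' := (p : ℤ)) rfl, complexMap_f, Category.assoc,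
      Category.assoc]
    change _ = (bicomplexXXIso U I q p).hom ≫ _ ≫ (bicomplexXXIso U I q' p).inv ≫ (bicomplexXXIso U I q' p).hom
    rw [Iso.inv_hom_id, Category.comp_id]

/-- **Row `p` of `Č•_ord(𝓤, I•)` is `Čᵖ(𝓤_p, I•)`** — the complex `PCech.complexC (faces U p) 0 I`, up to the `extend`
isomorphisms. [cite: GortzWedhorn2023, (21.19) (p. 262)] -/
def rowIsoC (p : ℕ) : (CechOrd.bicomplex U I).flip.X (p : ℤ) ≅ PCech.complexC (faces U p) 0 I :=
  Hom.isoOfComponents (fun q => CechOrd.bicomplexXXIso U I q p) fun q q' _ => by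
    change (CechOrd.bicomplexXXIso U I q p).hom ≫ Cech.map (faces U p) 0 (I.X q) (I.d q q') =
      ((CechOrd.bicomplex U I).d q q').f (p : ℤ) ≫ (CechOrd.bicomplexXXIso U I q' p).hom
    rw [CechOrd.bicomplex_d, extendMap_f _ ComplexShape.embeddingUpNat (i := p) (i' := (p : ℤ)) rfl, CechOrd.complexMap_f,
      Category.assoc, Category.assoc]
    change _ = (CechOrd.bicomplexXXIso U I q p).hom ≫ _ ≫ (CechOrd.bicomplexXXIso U I q' p).inv ≫
      (CechOrd.bicomplexXXIso U I q' p).hom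
    rw [Iso.inv_hom_id, Category.comp_id]

/-- **Row `p` of the counit of bicomplexes IS the counit `P̌ᵖ(𝓤_p, I•) ⟶ Čᵖ(𝓤_p, I•)`** (as an isomorphism of
arrows). [cite: GortzWedhorn2023, Lemma 22.36 (p. 349)] [cite: ThomasonTrobaugh1990, Appendix B, B.16] -/
def flipCounitArrowIso (p : ℕ) :
    Arrow.mk (PCech.counitComplexMap (faces U p) 0 I) ≅
      Arrow.mk (((HomologicalComplex₂.flipFunctor X.Modules (ComplexShape.up ℤ) (ComplexShape.up ℤ)).map
        (bicomplexCounit U I)).f (p : ℤ)) :=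
  Arrow.isoMk (rowIso U I p).symm (rowIsoC U I p).symm (by
    change (rowIso U I p).inv ≫ ((HomologicalComplex₂.flipFunctor X.Modules (ComplexShape.up ℤ)
        (ComplexShape.up ℤ)).map (bicomplexCounit U I)).f (p : ℤ) =
      PCech.counitComplexMap (faces U p) 0 I ≫ (rowIsoC U I p).inv
    ext q : 1
    rw [comp_f, comp_f]
    change (bicomplexXXIso U I q p).inv ≫ ((bicomplexCounit U I).f q).f (p : ℤ) =
      PCech.counit (faces U p) 0 (I.X q) ≫ (CechOrd.bicomplexXXIso U I q p).inv
    rw [bicomplexCounit_f, extendMap_f _ ComplexShape.embeddingUpNat (i := p) (i' := (p : ℤ)) rfl, counitComplex_f]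
    exact (Iso.inv_hom_id_assoc _ _))

/-- The rows of negative Čech degree: a map between zero complexes, a quasi-isomorphism.
[cite: Weibel1994, 1.2.6] -/
theorem quasiIso_flip_bicomplexCounit_f_of_neg (p : ℤ) (hp : p < 0) :
    QuasiIso (((HomologicalComplex₂.flipFunctor X.Modules (ComplexShape.up ℤ) (ComplexShape.up ℤ)).map
      (bicomplexCounit U I)).f p) :=
  quasiIso_of_isZero_X _ (fun q => isZero_bicomplex_X_X U I q p hp) (fun q => CechOrd.isZero_bicomplex_X_X U I q p hp)

end Rows

/-! ## §5 Separated schemes: the faces of an affine family are affine and meet affine opens in affines -/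

section Separated

variable [X.IsSeparated]

omit [Fintype ι] in
/-- **A non-empty finite intersection `U_s = ⋂_{i ∈ s} U_i` of affine opens of a separated scheme is affine.**
[cite: GortzWedhorn2023, Def. 21.68 (p. 260) and Thm. 22.9 (p. 332)] -/
theorem isAffineOpen_faceSet (hU : ∀ i, IsAffineOpen (U i)) {s : Finset ι} (hs : s.Nonempty) :
    IsAffineOpen (faceSet U s) := by
  classical
  induction s using Finset.induction_on with
  | empty => exact absurd hs Finset.not_nonempty_empty
  | insert a s ha ih =>
    rw [faceSet_insert]
    by_cases hs' : s.Nonempty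
    · exact (hU a).inf (ih hs')
    · rw [Finset.not_nonempty_iff_eq_empty.mp hs']
      have e : faceSet U (∅ : Finset ι) = ⊤ := by simp [faceSet]
      rw [e, inf_top_eq]
      exact hU a

omit [Fintype ι] in
/-- The faces `U_β` of the family of `p`-faces are affine (separated scheme, `U_i` affine).
[cite: GortzWedhorn2023, Thm. 22.9 (p. 332)] -/
theorem isAffineOpen_face_faces (hU : ∀ i, IsAffineOpen (U i)) {p : ℕ} (β : Idx ι p) :
    IsAffineOpen (face (faces U p) β) := by
  rw [face_faces]
  exact isAffineOpen_faceSet U hU (Finset.card_pos.mp (by rw [(β 0).2]; exact Nat.succ_pos p))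

omit [Fintype ι] in
/-- On a separated scheme with the `U_i` affine, the affine opens meeting every face in an affine open are ALL the
affine opens, hence form a basis. [cite: GortzWedhorn2023, Thm. 22.9 (p. 332)] -/
theorem isBasis_affine_inf_face (hU : ∀ i, IsAffineOpen (U i)) (p : ℕ) :
    Opens.IsBasis {V : X.Opens | IsAffineOpen V ∧ ∀ β : Idx ι p, IsAffineOpen (V ⊓ face (faces U p) β)} := by
  have e : {V : X.Opens | IsAffineOpen V ∧ ∀ β : Idx ι p, IsAffineOpen (V ⊓ face (faces U p) β)} = X.affineOpens := by
    ext V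
    exact ⟨fun h => h.1, fun h => ⟨h, fun β => IsAffineOpen.inf h (isAffineOpen_face_faces U hU β)⟩⟩
  rw [e]
  exact X.isBasis_affineOpens

end Separated

/-! ## §6 `Tot P̌•_ord(𝓤, I•) ⥲ Tot Č•_ord(𝓤, I•)` -/

section Total

variable [X.IsSeparated] (I : CochainComplex X.Modules ℤ) (hU : ∀ i, IsAffineOpen (U i))
  (hI : ∀ (q : ℤ) ⦃O : X.Opens⦄, IsAffineOpen O → IsAcyclicOn (I.X q) O)
  (hH : ∀ q : ℤ, IsAffineLocalizing (I.homology q)) (a : ℤ) [I.IsStrictlyGE a]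
include hU hI hH a

/-- **Every row of the counit of bicomplexes is a quasi-isomorphism** (`PCech.quasiIso_counitComplexMap` for the
family of `p`-faces, transported along `flipCounitArrowIso`; trivial in negative Čech degree).
[cite: GortzWedhorn2023, Lemma 22.36 (pp. 349–350)] [cite: ThomasonTrobaugh1990, Appendix B, B.16] -/
theorem quasiIso_flip_bicomplexCounit_f (p : ℤ) :
    QuasiIso (((HomologicalComplex₂.flipFunctor X.Modules (ComplexShape.up ℤ) (ComplexShape.up ℤ)).map
      (bicomplexCounit U I)).f p) := by
  rcases lt_or_ge p 0 with hp | hp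
  · exact quasiIso_flip_bicomplexCounit_f_of_neg U I p hp
  · obtain ⟨p, rfl⟩ := Int.eq_ofNat_of_zero_le hp
    haveI := PCech.quasiIso_counitComplexMap (faces U p) 0 I hI hH a (fun β => isAffineOpen_face_faces U hU β)
      (isBasis_affine_inf_face U hU p)
    exact quasiIso_of_arrow_mk_iso _ _ (flipCounitArrowIso U I p)

/-- **`Tot P̌•_ord(𝓤, I•) ⟶ Tot Č•_ord(𝓤, I•)` is a quasi-isomorphism** for a bounded-below complex `I•` of
`𝒪_X`-modules with terms acyclic on affine opens (e.g. injective) and affine-localizing (quasi-coherent) cohomology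
sheaves, on a separated scheme `X` with a finite family of affine opens `𝓤`: row-wise it is the quasi-isomorphism
`P̌ᵖ(𝓤_p, I•) ⥲ Čᵖ(𝓤_p, I•)` (quasi-coherent base change along the affine faces, Görtz–Wedhorn II Lemma 22.36), and
row-wise quasi-isomorphisms of first-quadrant bicomplexes induce quasi-isomorphisms of total complexes.
[cite: GortzWedhorn2023, Lemma 22.36 (pp. 349–350) and Lemma 21.75 (p. 264)] [cite: ThomasonTrobaugh1990, Appendix B, B.16]
[cite: HartshorneRD1966, II Cor. 7.19 (p. 133)] -/
theorem quasiIso_total_map_bicomplexCounit :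
    QuasiIso (HomologicalComplex₂.total.map (bicomplexCounit U I) (ComplexShape.up ℤ)) := by
  haveI := isStrictlyGE_bicomplex U I a
  haveI := CechOrd.isStrictlyGE_bicomplex U I a
  exact quasiIso_total_map_of_quasiIso_rows_of_isStrictlyGE (bicomplex U I) (CechOrd.bicomplex U I)
    (bicomplexCounit U I) a 0 (fun q => isStrictlyGE_columnFunctor_obj U (I.X q))
    (fun q => CechOrd.isStrictlyGE_columnFunctor_obj U (I.X q)) (fun p => quasiIso_flip_bicomplexCounit_f U I hU hI hH a p)

end Total

end PCechOrd

end Literature.AlgebraicGeometry.Modules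

end
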